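import Mathlib.Analysis.Convex.Cone.Extension
import Mathlib.Analysis.Convex.Gauge
import Mathlib.Analysis.LocallyConvex.Basic

/-!
# SmoothPoincare4 / SullivanDual — algebraic cone duality (helper for `RelativeSullivanDuality`)

Helper file for item stmt-SmoothPoincare4-7827 (`RelativeSullivanDuality`, support of route
SullivanDual). It proves the abstract engine of Sullivan's Hahn–Banach alternative
(Sullivan 1976, Thm. I.7; Harvey–Lawson 1983) in a bare real vector space `E` (no topology):

* `exists_linearMap_neg_on_convex_algOpen` — a convex, *algebraically open* set `C`
  (`c + t • b ∈ C` for `|t|` small, every direction `b`) with `0 ∉ C` is contained in an open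
  half-space `{g < 0}` of a linear functional `g` (gauge of `C - z₀` + Mathlib's
  `exists_extension_of_le_sublinear`);
* `exists_pos_functional_of_convex_cone_disjoint` — an algebraically open convex cone `Q`
  disjoint from an affine subspace `a + V` admits a linear `T` with `T > 0` on `Q`, `T = 0` on
  `V`, `T a ≤ 0` (the statement of the route's support item `AlgebraicConeDuality`, proved here
  universe-polymorphically as a lemma; `Q = ∅` gives `T = 0`).

No topology, no named facts; axioms `propext`, `Classical.choice`, `Quot.sound` only.
-/

-- the prescribed namespace `Summit.<P>.<Sub>.…` duplicates `SmoothPoincare4` (P = Sub)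
set_option linter.dupNamespace false

namespace Summit.SmoothPoincare4.SmoothPoincare4.Theorems

open Set

variable {E : Type*} [AddCommGroup E] [Module ℝ E]

/-- **Strict separation from the origin, algebraic form.** If `C ⊆ E` is convex, algebraically
open (for every `c ∈ C` and every direction `b`, `c + t • b ∈ C` for all `|t| ≤ δ`, some
`δ > 0`) and `0 ∉ C`, then some linear functional `g` is negative on all of `C`.
Proof: fix `z₀ ∈ C`; `D = C - z₀` is convex, absorbent, with `0 ∈ D`, `-z₀ ∉ D`, so its gauge
`p` is sublinear with `p (-z₀) ≥ 1` and `p < 1` on `D` (openness); extend `t • (-z₀) ↦ t p(-z₀)`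
dominated by `p` (`exists_extension_of_le_sublinear`) to `g`; then for `c ∈ C`,
`g c = g (c - z₀) - g (-z₀) < 1 - 1 = 0`. (Sullivan 1976, proof of Thm. I.7, the Hahn–Banach
step.) [folklore] -/
theorem exists_linearMap_neg_on_convex_algOpen {C : Set E} (hC : Convex ℝ C)
    (hopen : ∀ c ∈ C, ∀ b : E, ∃ δ : ℝ, 0 < δ ∧ ∀ t : ℝ, |t| ≤ δ → c + t • b ∈ C)
    (h0 : (0 : E) ∉ C) {z₀ : E} (hz₀ : z₀ ∈ C) :
    ∃ g : E →ₗ[ℝ] ℝ, ∀ c ∈ C, g c < 0 := by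
  -- the translate `D = C - z₀`
  set D : Set E := (fun d => d + z₀) ⁻¹' C with hD
  have hD0 : (0 : E) ∈ D := by simp [hD, hz₀]
  have hDconv : Convex ℝ D := hC.translate_preimage_left z₀
  have hDopen : ∀ d ∈ D, ∀ b : E, ∃ δ : ℝ, 0 < δ ∧ ∀ t : ℝ, |t| ≤ δ → d + t • b ∈ D := by
    intro d hd b
    obtain ⟨δ, hδ, h⟩ := hopen (d + z₀) hd b
    refine ⟨δ, hδ, fun t ht => ?_⟩
    show d + t • b + z₀ ∈ C
    rw [add_right_comm]
    exact h t ht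
  have hDabs : Absorbent ℝ D := by
    rw [absorbent_iff_eventually_nhdsNE_zero]
    intro x
    obtain ⟨δ, hδ, h⟩ := hDopen 0 hD0 x
    have hev : ∀ᶠ c : ℝ in nhds 0, |c| ≤ δ := by
      filter_upwards [Metric.closedBall_mem_nhds (0 : ℝ) hδ] with c hc
      simpa [Real.dist_eq] using hc
    filter_upwards [nhdsWithin_le_nhds hev] with c hc
    simpa using h c hc
  -- `-z₀ ∉ D`, so its gauge is at least `1`
  have hw : -z₀ ∉ D := by simpa [hD] using h0
  have hwne : (-z₀ : E) ≠ 0 := by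
    intro h
    apply h0
    have : z₀ = 0 := neg_eq_zero.1 h
    rwa [this] at hz₀
  have hγ : 1 ≤ gauge D (-z₀) :=
    one_le_gauge_of_notMem (hDconv.starConvex hD0) (hDabs.absorbs) hw
  -- the functional on the line through `-z₀`, dominated by the gauge
  have hfle : ∀ x : (LinearPMap.mkSpanSingleton (-z₀) (gauge D (-z₀)) hwne : E →ₗ.[ℝ] ℝ).domain,
      (LinearPMap.mkSpanSingleton (-z₀) (gauge D (-z₀)) hwne : E →ₗ.[ℝ] ℝ) x ≤ gauge D x := by
    rintro ⟨x, hx⟩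
    obtain ⟨a, rfl⟩ := Submodule.mem_span_singleton.1 hx
    rw [LinearPMap.mkSpanSingleton'_apply]
    simp only [RingHom.id_apply, smul_eq_mul]
    rcases le_or_gt 0 a with ha | ha
    · rw [gauge_smul_of_nonneg ha, smul_eq_mul]
    · have h1 : 0 ≤ gauge D (a • -z₀) := gauge_nonneg _
      have h2 : a * gauge D (-z₀) ≤ 0 :=
        mul_nonpos_of_nonpos_of_nonneg ha.le (gauge_nonneg _)
      exact h2.trans h1
  obtain ⟨g, hgf, hgle⟩ := exists_extension_of_le_sublinear
    (LinearPMap.mkSpanSingleton (-z₀) (gauge D (-z₀)) hwne : E →ₗ.[ℝ] ℝ) (gauge D)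
    (fun c hc x => by rw [gauge_smul_of_nonneg hc.le, smul_eq_mul])
    (gauge_add_le hDconv hDabs) hfle
  refine ⟨g, fun c hc => ?_⟩
  have hgw : g (-z₀) = gauge D (-z₀) := by
    have h1 := hgf ⟨-z₀, Submodule.mem_span_singleton_self _⟩
    rw [h1]
    exact LinearPMap.mkSpanSingleton_apply ℝ ℝ hwne _
  have hd : c - z₀ ∈ D := by
    show c - z₀ + z₀ ∈ C
    simpa using hc
  -- openness of `D` at `c - z₀` makes the gauge strictly smaller than `1`
  obtain ⟨δ, hδ, hδD⟩ := hDopen _ hd (c - z₀)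
  have h1 : (1 + δ) • (c - z₀) ∈ D := by
    rw [add_smul, one_smul]
    exact hδD δ (by rw [abs_of_pos hδ])
  have h2 : gauge D ((1 + δ) • (c - z₀)) ≤ 1 := gauge_le_one_of_mem h1
  rw [gauge_smul_of_nonneg (by linarith : (0 : ℝ) ≤ 1 + δ), smul_eq_mul] at h2
  have h3 : gauge D (c - z₀) < 1 := by
    by_contra h
    have h' : 1 ≤ gauge D (c - z₀) := not_lt.1 h
    nlinarith [gauge_nonneg (s := D) (c - z₀)]
  have h4 : g (c - z₀) < 1 := (hgle _).trans_lt h3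
  have h5 : g c = g (c - z₀) - g (-z₀) := by
    rw [map_sub, map_neg]; ring
  rw [h5, hgw]
  linarith

/-- **Algebraic cone duality** (the abstract engine of Sullivan's alternative, Sullivan 1976,
Thm. I.7): in a real vector space `E`, let `Q` be a convex cone (closed under positive scalings)
which is algebraically open, `V` a subspace and `a` a point with `(a + V) ∩ Q = ∅`. Then there is
a linear functional `T` with `T > 0` on `Q`, `T = 0` on `V` and `T a ≤ 0`.
Proof: if `Q = ∅` take `T = 0`. Otherwise `C = Q - a - V` is convex, algebraically open and
misses `0`; a functional `g < 0` on `C` (`exists_linearMap_neg_on_convex_algOpen`) is bounded on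
the subspace `V`, hence kills it, so `g q < g a` on `Q`; scaling in the cone gives `g ≤ 0` on `Q`
and `g a ≥ 0`, and openness upgrades `g ≤ 0` to `g < 0` on `Q`; take `T = -g`. This is the
statement of the route's support item `AlgebraicConeDuality` (stmt-SmoothPoincare4-7828), proved
here as a universe-polymorphic lemma. [folklore] -/
theorem exists_pos_functional_of_convex_cone_disjoint {Q : Set E} {V : Submodule ℝ E} {a : E}
    (hQc : Convex ℝ Q) (hcone : ∀ (c : ℝ) (q : E), 0 < c → q ∈ Q → c • q ∈ Q)
    (hopen : ∀ q ∈ Q, ∀ b : E, ∃ δ : ℝ, 0 < δ ∧ ∀ t : ℝ, |t| ≤ δ → q + t • b ∈ Q)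
    (hdisj : ∀ v ∈ V, a + v ∉ Q) :
    ∃ T : E →ₗ[ℝ] ℝ, (∀ q ∈ Q, 0 < T q) ∧ (∀ v ∈ V, T v = 0) ∧ T a ≤ 0 := by
  rcases Q.eq_empty_or_nonempty with hQ | ⟨q₀, hq₀⟩
  · exact ⟨0, by simp [hQ], by simp, by simp⟩
  -- `C = Q - a - V`
  set C : Set E := {z | ∃ q ∈ Q, ∃ v ∈ V, z = q - a - v} with hC
  have hCconv : Convex ℝ C := by
    rintro _ ⟨q₁, hq₁, v₁, hv₁, rfl⟩ _ ⟨q₂, hq₂, v₂, hv₂, rfl⟩ s t hs ht hst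
    refine ⟨s • q₁ + t • q₂, hQc hq₁ hq₂ hs ht hst, s • v₁ + t • v₂,
      V.add_mem (V.smul_mem s hv₁) (V.smul_mem t hv₂), ?_⟩
    have ha : a = s • a + t • a := by rw [← add_smul, hst, one_smul]
    conv_rhs => rw [ha]
    simp only [smul_sub]
    abel
  have hCopen : ∀ z ∈ C, ∀ b : E, ∃ δ : ℝ, 0 < δ ∧ ∀ t : ℝ, |t| ≤ δ → z + t • b ∈ C := by
    rintro _ ⟨q, hq, v, hv, rfl⟩ b
    obtain ⟨δ, hδ, h⟩ := hopen q hq b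
    exact ⟨δ, hδ, fun t ht => ⟨q + t • b, h t ht, v, hv, by abel⟩⟩
  have hC0 : (0 : E) ∉ C := by
    rintro ⟨q, hq, v, hv, h⟩
    apply hdisj v hv
    have : a + v = q := by
      rw [eq_comm, sub_sub, sub_eq_zero] at h
      exact h.symm
    rwa [this]
  have hz₀ : q₀ - a ∈ C := ⟨q₀, hq₀, 0, V.zero_mem, by simp⟩
  obtain ⟨g, hg⟩ := exists_linearMap_neg_on_convex_algOpen hCconv hCopen hC0 hz₀
  -- `g` kills `V`
  have hV : ∀ v ∈ V, g v = 0 := by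
    intro v hv
    by_contra hne
    have hmem : q₀ - a - ((g q₀ - g a) / g v) • v ∈ C :=
      ⟨q₀, hq₀, _, V.smul_mem _ hv, rfl⟩
    have h := hg _ hmem
    simp only [map_sub, map_smul, smul_eq_mul] at h
    rw [div_mul_cancel₀ _ hne] at h
    linarith
  -- `g q < g a` on `Q`
  have hlt : ∀ q ∈ Q, g q < g a := by
    intro q hq
    have hmem : q - a - (0 : E) ∈ C := ⟨q, hq, 0, V.zero_mem, rfl⟩
    have h := hg _ hmem
    simp only [sub_zero, map_sub] at h
    linarith
  -- scaling: `g ≤ 0` on `Q` and `0 ≤ g a`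
  have hgq : ∀ q ∈ Q, g q ≤ 0 := by
    intro q hq
    by_contra h'
    have h : 0 < g q := not_le.1 h'
    have hc : 0 < (|g a| + 1) / g q := div_pos (by positivity) h
    have h1 := hlt _ (hcone _ q hc hq)
    rw [map_smul, smul_eq_mul, div_mul_cancel₀ _ h.ne'] at h1
    linarith [le_abs_self (g a)]
  have hga : 0 ≤ g a := by
    by_contra h'
    have h : g a < 0 := not_le.1 h'
    have h0 := hlt q₀ hq₀
    have hq₀neg : g q₀ < 0 := h0.trans h
    have hne : g q₀ ≠ 0 := hq₀neg.ne
    have hc : 0 < g a / (2 * g q₀) := div_pos_of_neg_of_neg h (by linarith)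
    have h1 := hlt _ (hcone _ q₀ hc hq₀)
    rw [map_smul, smul_eq_mul] at h1
    have h2 : g a / (2 * g q₀) * g q₀ = g a / 2 := by
      field_simp
    rw [h2] at h1
    linarith
  refine ⟨-g, fun q hq => ?_, fun v hv => by simp [hV v hv], by simpa using hga⟩
  simp only [LinearMap.neg_apply, Left.neg_pos_iff]
  rcases (hgq q hq).lt_or_eq with h | h
  · exact h
  · exfalso
    -- openness at `q` in the direction `a - q₀`, where `g (a - q₀) > 0`
    obtain ⟨δ, hδ, hδQ⟩ := hopen q hq (a - q₀)
    have hmem := hδQ δ (by rw [abs_of_pos hδ])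
    have h1 := hgq _ hmem
    simp only [map_add, map_smul, map_sub, smul_eq_mul, h, zero_add] at h1
    have h2 := hlt q₀ hq₀
    nlinarith

end Summit.SmoothPoincare4.SmoothPoincare4.Theorems
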